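import Mathlib.Analysis.SpecialFunctions.Pow.Real
import Mathlib.Analysis.SpecialFunctions.Log.Base
import Mathlib.Algebra.Order.Field.GeomSum
import Mathlib.Algebra.Order.Ring.Pow
import Mathlib.Algebra.Order.Archimedean.Basic
import Mathlib.Algebra.BigOperators.Intervals

/-!
# The renewal-inequality induction behind `stub_chainDecay`

Line `radial-renewal-kesten-inequality` of the crux `AnnularMassDecay` (stmt-CriticalPhenomena-4729),
helper for stub S5 (`stub_chainDecay`).  Pure real analysis, no walks: an abstract "mass"
`D x s` attached to states `x` (with a "radius" `ρ x`) and levels `s ≥ 1` which is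

* bounded (`D x s ≤ K₀` for `s ≥ 1`), and
* for `1 ≤ s < ρ x / A` obeys a one-step RENEWAL INEQUALITY
  `D x s ≤ Σ_{i ∈ T} w i · D (y i) s + Cs · (ρ x / (A s))^{-κ}` over finitely many children `y i`
  with radii `ρ (y i) ≤ ρ x / A`, nonnegative weights of total mass `Σ w ≤ 1 - ε` (contraction) whose
  deep part is polynomially small (`Σ_{ρ (y i) ≤ ρ x /(A B)} w i ≤ Cs · B^{-κ}` for `1 ≤ B`, `A B ≤ ρ x`),

decays polynomially: `D x r ≤ C (r / ρ x)^θ` for `1 ≤ r < ρ x`, with `θ > 0` and `C` depending only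
on `A, ε, κ, Cs, K₀` (`rr_decay_of_renewal_inequality`, registered on the crux item).  Proof: classify
`(x, s)` by the least `j` with `ρ x / s ≤ A^{j+1}` and prove `D x s ≤ K λ^j` by strong induction on
`j` (`rr_ci_step` is the algebra of one step: children of class `≥ j - d₀` carry total weight
`≤ 1 - ε ≤ (1 - ε/2) λ^{d₀}`, children of class `j - d` with `d > d₀` have weight `≤ Cs A^{-κ(d-2)}`,
summed geometrically against `λ^{-d}` thanks to `λ ≥ A^{-κ/2}`, and the skip term is
`≤ Cs A^{κ} A^{-κ j}`); finally `λ^j ≤ A^θ (r/ρ x)^θ` with `θ = -log_A λ`.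
Sources: W. Feller, *An Introduction to Probability Theory and its Applications* II, XIII (renewal
inequalities); N. Madras, G. Slade, *The Self-Avoiding Walk* (1993), App. A. [folklore]
-/

noncomputable section

namespace Summit.CriticalPhenomena.SAWScalingLimit.Theorems.AnnularMassDecay.Radial

open scoped BigOperators Classical

/-- `(A^n)^{-κ} = (A^{-κ/2})^{2n}` for `A ≥ 0`. [folklore] -/
theorem rr_ci_pow_rpow_neg {A : ℝ} (hA : 0 ≤ A) (κ : ℝ) (n : ℕ) :
    (A ^ n) ^ (-κ) = (A ^ (-κ / 2)) ^ (2 * n) := by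
  rw [← Real.rpow_natCast_mul hA, ← Real.rpow_mul_natCast hA]
  congr 1
  push_cast
  ring

/-- **One step of the renewal-inequality induction** (pure finite-sum algebra).  Children `i ∈ T`
carry weights `w i ≥ 0` of total mass `≤ 1 - ε`, classes `c i < j` and masses
`Dy i ≤ K λ^{c i}`; the children of class `j - d` with `d > d₀` have total weight `≤ Cs a^{2(d-2)}`
(`a ≤ λ ≤ 1`, `a < 1`); the skip term is `≤ Cs a^{2(j-1)}`; and the constants satisfy
`1 - ε ≤ (1 - ε/2) λ^{d₀}`, `Cs a^{d₀+1} ≤ (ε/4)(1-a)a^4`, `Cs ≤ (K ε/4) a^2`.  Then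
`Σ w i · Dy i + skip ≤ K λ^j`. [folklore] -/
theorem rr_ci_step {ι : Type*} (T : Finset ι) (w : ι → ℝ) (c : ι → ℕ) (Dy : ι → ℝ) {j d₀ : ℕ}
    (hj : 1 ≤ j) (hd₀ : 1 ≤ d₀) {lam a ε Cs K Dxs skip : ℝ}
    (hw : ∀ i ∈ T, 0 ≤ w i) (hsum : ∑ i ∈ T, w i ≤ 1 - ε) (hε : 0 < ε)
    (ha0 : 0 < a) (halam : a ≤ lam) (hlam1 : lam ≤ 1) (ha1 : a < 1)
    (hτ : 1 - ε ≤ (1 - ε / 2) * lam ^ d₀)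
    (hC1 : Cs * a ^ (d₀ + 1) ≤ (ε / 4) * ((1 - a) * a ^ 4))
    (hC3 : Cs ≤ K * ε / 4 * a ^ 2) (hK : 0 ≤ K) (hCs : 0 ≤ Cs)
    (hIH : ∀ i ∈ T, Dy i ≤ K * lam ^ (c i)) (hc : ∀ i ∈ T, c i < j)
    (hband : ∀ d : ℕ, d₀ < d → d ≤ j →
      ∑ i ∈ T.filter (fun i => c i + d = j), w i ≤ Cs * a ^ (2 * (d - 2)))
    (hskip : skip ≤ Cs * a ^ (2 * (j - 1)))
    (hmain : Dxs ≤ (∑ i ∈ T, w i * Dy i) + skip) :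
    Dxs ≤ K * lam ^ j := by
  have hlam0 : 0 < lam := ha0.trans_le halam
  have h1a : 0 < 1 - a := by linarith
  -- Part 1: the shallow children (class `≥ j - d₀`)
  have hP1 : ∑ i ∈ T.filter (fun i => j ≤ c i + d₀), w i * lam ^ (c i) ≤ (1 - ε / 2) * lam ^ j := by
    have hpos : 0 < lam ^ d₀ := pow_pos hlam0 _
    refine le_of_mul_le_mul_right ?_ hpos
    calc (∑ i ∈ T.filter (fun i => j ≤ c i + d₀), w i * lam ^ (c i)) * lam ^ d₀
        = ∑ i ∈ T.filter (fun i => j ≤ c i + d₀), w i * lam ^ (c i + d₀) := by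
          rw [Finset.sum_mul]
          refine Finset.sum_congr rfl fun i _ => ?_
          rw [pow_add]
          ring
      _ ≤ ∑ i ∈ T.filter (fun i => j ≤ c i + d₀), w i * lam ^ j := by
          refine Finset.sum_le_sum fun i hi => ?_
          obtain ⟨hiT, hij⟩ := Finset.mem_filter.1 hi
          exact mul_le_mul_of_nonneg_left (pow_le_pow_of_le_one hlam0.le hlam1 hij) (hw i hiT)
      _ = (∑ i ∈ T.filter (fun i => j ≤ c i + d₀), w i) * lam ^ j := (Finset.sum_mul _ _ _).symm
      _ ≤ (∑ i ∈ T, w i) * lam ^ j :=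
          mul_le_mul_of_nonneg_right
            (Finset.sum_le_sum_of_subset_of_nonneg (Finset.filter_subset _ _) fun i hi _ => hw i hi)
            (pow_nonneg hlam0.le _)
      _ ≤ (1 - ε) * lam ^ j := mul_le_mul_of_nonneg_right hsum (pow_nonneg hlam0.le _)
      _ ≤ (1 - ε / 2) * lam ^ d₀ * lam ^ j := mul_le_mul_of_nonneg_right hτ (pow_nonneg hlam0.le _)
      _ = (1 - ε / 2) * lam ^ j * lam ^ d₀ := by ring
  -- Part 2: the deep children (class `j - d`, `d > d₀`), fibred over `d`
  have hP2 : ∑ i ∈ T.filter (fun i => ¬ (j ≤ c i + d₀)), w i * lam ^ (c i) ≤ ε / 4 * lam ^ j := by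
    set T₂ := T.filter (fun i => ¬ (j ≤ c i + d₀)) with hT₂
    have hmaps : ∀ i ∈ T₂, j - c i ∈ Finset.Ico (d₀ + 1) (j + 1) := by
      intro i hi
      obtain ⟨hiT, hij⟩ := Finset.mem_filter.1 hi
      have := hc i hiT
      simp only [Finset.mem_Ico]
      omega
    rw [← Finset.sum_fiberwise_of_maps_to hmaps]
    have hfib : ∀ d ∈ Finset.Ico (d₀ + 1) (j + 1),
        ∑ i ∈ T₂.filter (fun i => j - c i = d), w i * lam ^ (c i) ≤
          Cs * lam ^ j / a ^ 4 * a ^ d := by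
      intro d hd
      rw [Finset.mem_Ico] at hd
      have hd2 : 2 ≤ d := by omega
      have hdj : d ≤ j := by omega
      calc ∑ i ∈ T₂.filter (fun i => j - c i = d), w i * lam ^ (c i)
          = ∑ i ∈ T₂.filter (fun i => j - c i = d), w i * lam ^ (j - d) := by
            refine Finset.sum_congr rfl fun i hi => ?_
            obtain ⟨hi2, hid⟩ := Finset.mem_filter.1 hi
            have hcj := hc i (Finset.mem_filter.1 hi2).1
            rw [show c i = j - d by omega]
        _ = (∑ i ∈ T₂.filter (fun i => j - c i = d), w i) * lam ^ (j - d) :=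
            (Finset.sum_mul _ _ _).symm
        _ ≤ (∑ i ∈ T.filter (fun i => c i + d = j), w i) * lam ^ (j - d) := by
            refine mul_le_mul_of_nonneg_right ?_ (pow_nonneg hlam0.le _)
            refine Finset.sum_le_sum_of_subset_of_nonneg ?_
              fun i hi _ => hw i (Finset.mem_filter.1 hi).1
            intro i hi
            simp only [Finset.mem_filter, hT₂] at hi ⊢
            have hcj := hc i hi.1.1
            exact ⟨hi.1.1, by omega⟩
        _ ≤ Cs * a ^ (2 * (d - 2)) * lam ^ (j - d) :=
            mul_le_mul_of_nonneg_right (hband d (by omega) hdj) (pow_nonneg hlam0.le _)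
        _ ≤ Cs * lam ^ j / a ^ 4 * a ^ d := by
            rw [div_mul_eq_mul_div, le_div_iff₀ (pow_pos ha0 4)]
            have h1 : a ^ (2 * (d - 2)) * a ^ 4 = a ^ d * a ^ d := by
              rw [← pow_add, ← pow_add]
              congr 1
              omega
            have h2 : a ^ d ≤ lam ^ d := pow_le_pow_left₀ ha0.le halam d
            have h3 : lam ^ (j - d) * lam ^ d = lam ^ j := by
              rw [← pow_add, Nat.sub_add_cancel hdj]
            calc Cs * a ^ (2 * (d - 2)) * lam ^ (j - d) * a ^ 4
                = Cs * lam ^ (j - d) * (a ^ (2 * (d - 2)) * a ^ 4) := by ring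
              _ = Cs * lam ^ (j - d) * (a ^ d * a ^ d) := by rw [h1]
              _ ≤ Cs * lam ^ (j - d) * (lam ^ d * a ^ d) := by
                  refine mul_le_mul_of_nonneg_left ?_ (mul_nonneg hCs (pow_nonneg hlam0.le _))
                  exact mul_le_mul_of_nonneg_right h2 (pow_nonneg ha0.le _)
              _ = Cs * (lam ^ (j - d) * lam ^ d) * a ^ d := by ring
              _ = Cs * lam ^ j * a ^ d := by rw [h3]
    have hnn : 0 ≤ Cs * lam ^ j / a ^ 4 :=
      div_nonneg (mul_nonneg hCs (pow_nonneg hlam0.le _)) (pow_nonneg ha0.le _)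
    calc ∑ d ∈ Finset.Ico (d₀ + 1) (j + 1), ∑ i ∈ T₂.filter (fun i => j - c i = d), w i * lam ^ (c i)
        ≤ ∑ d ∈ Finset.Ico (d₀ + 1) (j + 1), Cs * lam ^ j / a ^ 4 * a ^ d := Finset.sum_le_sum hfib
      _ = Cs * lam ^ j / a ^ 4 * ∑ d ∈ Finset.Ico (d₀ + 1) (j + 1), a ^ d :=
          (Finset.mul_sum _ _ _).symm
      _ ≤ Cs * lam ^ j / a ^ 4 * (a ^ (d₀ + 1) / (1 - a)) :=
          mul_le_mul_of_nonneg_left (geom_sum_Ico_le_of_lt_one ha0.le ha1) hnn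
      _ = lam ^ j * (Cs * a ^ (d₀ + 1)) / ((1 - a) * a ^ 4) := by
          field_simp
      _ ≤ lam ^ j * (ε / 4 * ((1 - a) * a ^ 4)) / ((1 - a) * a ^ 4) := by
          refine div_le_div_of_nonneg_right ?_ (mul_pos h1a (pow_pos ha0 4)).le
          exact mul_le_mul_of_nonneg_left hC1 (pow_nonneg hlam0.le _)
      _ = ε / 4 * lam ^ j := by
          field_simp
  -- Part 3: the skip term
  have hP3 : skip ≤ K * ε / 4 * lam ^ j := by
    have ha2 : a ^ 2 ≤ lam := (pow_le_of_le_one ha0.le ha1.le two_ne_zero).trans halam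
    calc skip ≤ Cs * a ^ (2 * (j - 1)) := hskip
      _ ≤ K * ε / 4 * a ^ 2 * a ^ (2 * (j - 1)) := mul_le_mul_of_nonneg_right hC3 (pow_nonneg ha0.le _)
      _ = K * ε / 4 * (a ^ 2) ^ j := by
          rw [mul_assoc, ← pow_add, ← pow_mul]
          congr 2
          omega
      _ ≤ K * ε / 4 * lam ^ j :=
          mul_le_mul_of_nonneg_left (pow_le_pow_left₀ (sq_nonneg a) ha2 j) (by positivity)
  -- assembling
  have hS : ∑ i ∈ T, w i * Dy i ≤ K * ((1 - ε / 2) * lam ^ j + ε / 4 * lam ^ j) := by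
    calc ∑ i ∈ T, w i * Dy i ≤ ∑ i ∈ T, K * (w i * lam ^ (c i)) := by
          refine Finset.sum_le_sum fun i hi => ?_
          calc w i * Dy i ≤ w i * (K * lam ^ (c i)) := mul_le_mul_of_nonneg_left (hIH i hi) (hw i hi)
            _ = K * (w i * lam ^ (c i)) := by ring
      _ = K * ∑ i ∈ T, w i * lam ^ (c i) := (Finset.mul_sum _ _ _).symm
      _ = K * ((∑ i ∈ T.filter (fun i => j ≤ c i + d₀), w i * lam ^ (c i)) +
            ∑ i ∈ T.filter (fun i => ¬ (j ≤ c i + d₀)), w i * lam ^ (c i)) := by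
          rw [Finset.sum_filter_add_sum_filter_not]
      _ ≤ K * ((1 - ε / 2) * lam ^ j + ε / 4 * lam ^ j) :=
          mul_le_mul_of_nonneg_left (add_le_add hP1 hP2) hK
  calc Dxs ≤ (∑ i ∈ T, w i * Dy i) + skip := hmain
    _ ≤ K * ((1 - ε / 2) * lam ^ j + ε / 4 * lam ^ j) + K * ε / 4 * lam ^ j := add_le_add hS hP3
    _ = K * lam ^ j := by ring

/-- **Constants and induction.**  Normalised form of `rr_decay_of_renewal_inequality`
(`0 < ε ≤ 1`, `0 ≤ Cs`): the exponent `θ` and the constant `C` are built from `A, ε, κ, Cs, K₀`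
alone, before the data `X, ρ, D` are introduced. [folklore] -/
theorem rr_ci_core {A ε κ Cs K₀ : ℝ} (hA : 1 < A) (hε : 0 < ε) (hε1 : ε ≤ 1) (hκ : 0 < κ)
    (hCs : 0 ≤ Cs) :
    ∃ θ C : ℝ, 0 < θ ∧ ∀ (X ι : Type) (ρ : X → ℝ) (D : X → ℝ → ℝ),
      (∀ (x : X) (s : ℝ), 1 ≤ s → D x s ≤ K₀) →
      (∀ (x : X) (s : ℝ), 1 ≤ s → s < ρ x / A → ∃ (T : Finset ι) (w : ι → ℝ) (y : ι → X),
        (∀ i ∈ T, 0 ≤ w i) ∧ (∀ i ∈ T, ρ (y i) ≤ ρ x / A) ∧ (∑ i ∈ T, w i) ≤ 1 - ε ∧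
        (∀ B : ℝ, 1 ≤ B → A * B ≤ ρ x →
          (∑ i ∈ T.filter (fun i => ρ (y i) ≤ ρ x / (A * B)), w i) ≤ Cs * B ^ (-κ)) ∧
        D x s ≤ (∑ i ∈ T, w i * D (y i) s) + Cs * (ρ x / (A * s)) ^ (-κ)) →
      ∀ (x : X) (r : ℝ), 1 ≤ r → r < ρ x → D x r ≤ C * (r / ρ x) ^ θ := by
  have hA0 : 0 < A := by linarith
  -- the contraction scale `a = A^{-κ/2}`
  obtain ⟨a, ha_def⟩ : ∃ a : ℝ, a = A ^ (-κ / 2) := ⟨_, rfl⟩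
  have ha0 : 0 < a := ha_def ▸ Real.rpow_pos_of_pos hA0 _
  have ha1 : a < 1 := ha_def ▸ Real.rpow_lt_one_of_one_lt_of_neg hA (by linarith)
  have h1a : 0 < 1 - a := by linarith
  -- the depth `d₀` beyond which the deep bands are negligible
  obtain ⟨d₀, hd₀, hC1⟩ : ∃ d₀ : ℕ, 1 ≤ d₀ ∧ Cs * a ^ (d₀ + 1) ≤ (ε / 4) * ((1 - a) * a ^ 4) := by
    have hδ : 0 < (ε / 4) * ((1 - a) * a ^ 4) / (Cs + 1) :=
      div_pos (mul_pos (by linarith) (mul_pos h1a (pow_pos ha0 4))) (by linarith)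
    obtain ⟨n, hn⟩ := exists_pow_lt_of_lt_one hδ ha1
    refine ⟨n + 1, by omega, ?_⟩
    have h1 : a ^ (n + 1 + 1) ≤ a ^ n := pow_le_pow_of_le_one ha0.le ha1.le (by omega)
    calc Cs * a ^ (n + 1 + 1) ≤ (Cs + 1) * a ^ n := by
          nlinarith [pow_nonneg ha0.le (n + 1 + 1), pow_nonneg ha0.le n]
      _ ≤ (Cs + 1) * ((ε / 4) * ((1 - a) * a ^ 4) / (Cs + 1)) :=
          mul_le_mul_of_nonneg_left hn.le (by linarith)
      _ = (ε / 4) * ((1 - a) * a ^ 4) := by field_simp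
  -- the rate `lam ∈ [a, 1)` with `(1 - ε) ≤ (1 - ε/2) lam^{d₀}` (Bernoulli)
  obtain ⟨lam, halam, hlam1, hτ⟩ :
      ∃ lam : ℝ, a ≤ lam ∧ lam < 1 ∧ 1 - ε ≤ (1 - ε / 2) * lam ^ d₀ := by
    have h2 : 0 < 1 - ε / 2 := by linarith
    obtain ⟨τ, hτ_def⟩ : ∃ τ : ℝ, τ = (1 - ε) / (1 - ε / 2) := ⟨_, rfl⟩
    have hτ0 : 0 ≤ τ := hτ_def ▸ div_nonneg (by linarith) h2.le
    have hτ1 : τ < 1 := hτ_def ▸ (div_lt_one h2).2 (by linarith)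
    have hd : (1 : ℝ) ≤ d₀ := Nat.one_le_cast.2 hd₀
    have hdiv : (1 - τ) / d₀ ≤ 1 - τ := div_le_self (by linarith) hd
    have hdiv0 : 0 < (1 - τ) / d₀ := div_pos (by linarith) (by linarith)
    have hbern : τ ≤ (1 - (1 - τ) / d₀) ^ d₀ := by
      have h := one_add_mul_le_pow (a := -((1 - τ) / d₀)) (by linarith) d₀
      have e1 : 1 + (d₀ : ℝ) * (-((1 - τ) / d₀)) = τ := by
        field_simp
        ring
      have e2 : 1 + -((1 - τ) / (d₀ : ℝ)) = 1 - (1 - τ) / d₀ := by ring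
      rwa [e1, e2] at h
    refine ⟨max a (1 - (1 - τ) / d₀), le_max_left _ _, max_lt ha1 (by linarith), ?_⟩
    calc 1 - ε = τ * (1 - ε / 2) := by rw [hτ_def, div_mul_cancel₀ _ h2.ne']
      _ = (1 - ε / 2) * τ := mul_comm _ _
      _ ≤ (1 - ε / 2) * (1 - (1 - τ) / d₀) ^ d₀ := mul_le_mul_of_nonneg_left hbern h2.le
      _ ≤ (1 - ε / 2) * (max a (1 - (1 - τ) / d₀)) ^ d₀ :=
          mul_le_mul_of_nonneg_left
            (pow_le_pow_left₀ (by linarith) (le_max_right _ _) _) h2.le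
  have hlam0 : 0 < lam := ha0.trans_le halam
  -- the constant `K` of the induction claim
  obtain ⟨K, hK_def⟩ : ∃ K : ℝ, K = max K₀ (4 * Cs / (ε * a ^ 2)) := ⟨_, rfl⟩
  have hKK₀ : K₀ ≤ K := hK_def ▸ le_max_left _ _
  have hεa : 0 < ε * a ^ 2 := mul_pos hε (pow_pos ha0 2)
  have hC3 : Cs ≤ K * ε / 4 * a ^ 2 := by
    have h : 4 * Cs / (ε * a ^ 2) ≤ K := hK_def ▸ le_max_right _ _
    rw [div_le_iff₀ hεa] at h
    linarith
  have hK : 0 ≤ K :=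
    le_trans (div_nonneg (by linarith) hεa.le) (hK_def ▸ le_max_right _ _)
  -- the exponent
  obtain ⟨θ, hθ_def⟩ : ∃ θ : ℝ, θ = -Real.logb A lam := ⟨_, rfl⟩
  have hθ : 0 < θ := hθ_def ▸ neg_pos.2 (Real.logb_neg hA hlam0 hlam1)
  have hlamθ : A ^ (-θ) = lam := by
    rw [hθ_def, neg_neg]
    exact Real.rpow_logb hA0 hA.ne' hlam0
  refine ⟨θ, K * A ^ θ, hθ, ?_⟩
  intro X ι ρ D hbdd hstep
  -- the class of a ratio `q`: the least `j` with `q ≤ A^{j+1}`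
  obtain ⟨cls, hcls, hmin⟩ : ∃ cls : ℝ → ℕ, (∀ q, q ≤ A ^ (cls q + 1)) ∧
      ∀ q (j : ℕ), q ≤ A ^ (j + 1) → cls q ≤ j := by
    have hex : ∀ q : ℝ, ∃ j : ℕ, q ≤ A ^ (j + 1) := fun q => by
      obtain ⟨n, hn⟩ := pow_unbounded_of_one_lt q hA
      exact ⟨n, hn.le.trans (pow_le_pow_right₀ hA.le (Nat.le_succ n))⟩
    exact ⟨fun q => Nat.find (hex q), fun q => Nat.find_spec (hex q),
      fun q j hj => Nat.find_min' (hex q) hj⟩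
  have hlow : ∀ q (j : ℕ), cls q = j → 1 ≤ j → A ^ j < q := by
    intro q j hj hj1
    by_contra h
    have h' : q ≤ A ^ (j - 1 + 1) := by rwa [Nat.sub_add_cancel hj1, ← not_lt]
    have := hmin q (j - 1) h'
    omega
  -- the induction claim
  have claim : ∀ j : ℕ, ∀ (x : X) (s : ℝ), 1 ≤ s → cls (ρ x / s) = j → D x s ≤ K * lam ^ j := by
    intro j
    induction j using Nat.strong_induction_on with
    | _ j ih =>
    intro x s hs hj
    rcases Nat.eq_zero_or_pos j with rfl | hj1
    · rw [pow_zero, mul_one]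
      exact (hbdd x s hs).trans hKK₀
    have hs0 : 0 < s := by linarith
    have hq : A ^ j < ρ x / s := hlow _ _ hj hj1
    have hq' : ρ x / s ≤ A ^ (j + 1) := hj ▸ hcls _
    have hAs : A ^ j * s < ρ x := (lt_div_iff₀ hs0).1 hq
    have hAj : A ≤ A ^ j := le_self_pow₀ hA.le hj1.ne'
    have hρ : 0 < ρ x := lt_of_le_of_lt (by positivity) hAs
    have hsA : s < ρ x / A := by
      rw [lt_div_iff₀ hA0]
      nlinarith
    obtain ⟨T, w, y, hw, hyA, hsum, hband, hmain⟩ := hstep x s hs hsA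
    -- the children drop at least one class
    have hc : ∀ i ∈ T, cls (ρ (y i) / s) < j := fun i hi => by
      have h1 : ρ (y i) / s ≤ A ^ (j - 1 + 1) := by
        rw [Nat.sub_add_cancel hj1]
        calc ρ (y i) / s ≤ (ρ x / A) / s := div_le_div_of_nonneg_right (hyA i hi) hs0.le
          _ = (ρ x / s) / A := by rw [div_right_comm]
          _ ≤ A ^ (j + 1) / A := div_le_div_of_nonneg_right hq' hA0.le
          _ = A ^ j := by rw [pow_succ, mul_div_cancel_right₀ _ hA0.ne']
      have := hmin _ _ h1
      omega
    have hIH : ∀ i ∈ T, D (y i) s ≤ K * lam ^ (cls (ρ (y i) / s)) :=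
      fun i hi => ih _ (hc i hi) (y i) s hs rfl
    -- the deep bands are polynomially small
    have hband' : ∀ d : ℕ, d₀ < d → d ≤ j →
        ∑ i ∈ T.filter (fun i => cls (ρ (y i) / s) + d = j), w i ≤ Cs * a ^ (2 * (d - 2)) := by
      intro d hd hdj
      have hB1 : (1 : ℝ) ≤ A ^ (d - 2) := one_le_pow₀ hA.le
      have hAB : A * A ^ (d - 2) ≤ ρ x := by
        rw [← pow_succ']
        calc A ^ (d - 2 + 1) ≤ A ^ j := pow_le_pow_right₀ hA.le (by omega)
          _ ≤ ρ x := hq.le.trans (div_le_self hρ.le hs)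
      have key := hband (A ^ (d - 2)) hB1 hAB
      rw [rr_ci_pow_rpow_neg hA0.le, ← ha_def] at key
      refine le_trans (Finset.sum_le_sum_of_subset_of_nonneg ?_ ?_) key
      · intro i hi
        simp only [Finset.mem_filter] at hi ⊢
        refine ⟨hi.1, ?_⟩
        have h1 : ρ (y i) / s ≤ A ^ (j - d + 1) := by
          have h := hcls (ρ (y i) / s)
          rwa [show cls (ρ (y i) / s) = j - d by omega] at h
        have h2 : ρ (y i) ≤ A ^ (j - d + 1) * s := (div_le_iff₀ hs0).1 h1
        have he : j - d + 1 + (d - 2 + 1) = j := by omega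
        rw [le_div_iff₀ (by positivity)]
        calc ρ (y i) * (A * A ^ (d - 2)) ≤ A ^ (j - d + 1) * s * (A * A ^ (d - 2)) :=
              mul_le_mul_of_nonneg_right h2 (by positivity)
          _ = A ^ (j - d + 1 + (d - 2 + 1)) * s := by
              rw [pow_add, pow_succ]
              ring
          _ = A ^ j * s := by rw [he]
          _ ≤ ρ x := hAs.le
      · exact fun i hi _ => hw i (Finset.mem_filter.1 hi).1
    -- the skip term
    have hskip' : Cs * (ρ x / (A * s)) ^ (-κ) ≤ Cs * a ^ (2 * (j - 1)) := by
      refine mul_le_mul_of_nonneg_left ?_ hCs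
      rw [ha_def, ← rr_ci_pow_rpow_neg hA0.le]
      refine Real.rpow_le_rpow_of_nonpos (pow_pos hA0 _) ?_ (by linarith)
      rw [le_div_iff₀ (by positivity)]
      calc A ^ (j - 1) * (A * s) = A ^ (j - 1 + 1) * s := by
            rw [pow_succ]
            ring
        _ = A ^ j * s := by rw [Nat.sub_add_cancel hj1]
        _ ≤ ρ x := hAs.le
    exact rr_ci_step T w (fun i => cls (ρ (y i) / s)) (fun i => D (y i) s) hj1 hd₀ hw hsum hε
      ha0 halam hlam1.le ha1 hτ hC1 hC3 hK hCs hIH hc hband' hskip' hmain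
  -- conversion of the claim into the power law
  intro x r hr hrρ
  have hr0 : 0 < r := by linarith
  have hρ : 0 < ρ x := by linarith
  have h1 := claim (cls (ρ x / r)) x r hr rfl
  have hq' : ρ x / r ≤ A ^ (cls (ρ x / r) + 1) := hcls _
  have h2 : lam ^ (cls (ρ x / r)) ≤ A ^ θ * (r / ρ x) ^ θ := by
    have hqA : ρ x / r / A ≤ A ^ (cls (ρ x / r)) := by
      rw [div_le_iff₀ hA0, ← pow_succ]
      exact hq'
    calc lam ^ (cls (ρ x / r)) = (A ^ (cls (ρ x / r))) ^ (-θ) := by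
          rw [← hlamθ, ← Real.rpow_mul_natCast hA0.le, ← Real.rpow_natCast_mul hA0.le]
          congr 1
          ring
      _ ≤ (ρ x / r / A) ^ (-θ) := Real.rpow_le_rpow_of_nonpos (by positivity) hqA (by linarith)
      _ = (A * (r / ρ x)) ^ θ := by
          rw [Real.rpow_neg (by positivity), ← Real.inv_rpow (by positivity)]
          congr 1
          field_simp
      _ = A ^ θ * (r / ρ x) ^ θ := Real.mul_rpow hA0.le (by positivity)
  calc D x r ≤ K * lam ^ (cls (ρ x / r)) := h1
    _ ≤ K * (A ^ θ * (r / ρ x) ^ θ) := mul_le_mul_of_nonneg_left h2 hK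
    _ = K * A ^ θ * (r / ρ x) ^ θ := by ring

/-- **`rr_decay_of_renewal_inequality`** — the abstract renewal-inequality induction of the line
`radial-renewal-kesten-inequality` (crux `AnnularMassDecay`, stmt-CriticalPhenomena-4729; helper
registered for stub S5 `stub_chainDecay`).  Given `A > 1`, `ε > 0`, `κ > 0`, `Cs`, `K₀` there are
`θ > 0` and `C` such that for ANY states `X` with radii `ρ : X → ℝ` and masses `D : X → ℝ → ℝ`
which are bounded by `K₀` at levels `s ≥ 1` and satisfy, for `1 ≤ s < ρ x / A`, the renewal
inequality `D x s ≤ Σ_{i ∈ T} w i · D (y i) s + Cs (ρ x/(A s))^{-κ}` with finitely many children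
`y i` of radii `≤ ρ x / A`, weights `w i ≥ 0` of total mass `≤ 1 - ε` and band masses
`Σ_{ρ (y i) ≤ ρ x/(A B)} w i ≤ Cs B^{-κ}` (`1 ≤ B`, `A B ≤ ρ x`), one has
`D x r ≤ C (r / ρ x)^θ` for all `1 ≤ r < ρ x`.  (Reduction to `rr_ci_core` with `min ε 1`,
`max Cs 0`.) [folklore] -/
theorem rr_decay_of_renewal_inequality : ∀ (A ε κ Cs K₀ : ℝ), 1 < A → 0 < ε → 0 < κ → ∃ θ C : ℝ, 0 < θ ∧ ∀ (X ι : Type) (ρ : X → ℝ) (D : X → ℝ → ℝ), (∀ (x : X) (s : ℝ), 1 ≤ s → D x s ≤ K₀) → (∀ (x : X) (s : ℝ), 1 ≤ s → s < ρ x / A → ∃ (T : Finset ι) (w : ι → ℝ) (y : ι → X), (∀ i ∈ T, 0 ≤ w i) ∧ (∀ i ∈ T, ρ (y i) ≤ ρ x / A) ∧ (∑ i ∈ T, w i) ≤ 1 - ε ∧ (∀ B : ℝ, 1 ≤ B → A * B ≤ ρ x → (∑ i ∈ T.filter (fun i => ρ (y i) ≤ ρ x / (A * B)), w i) ≤ Cs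 * B ^ (-κ)) ∧ D x s ≤ (∑ i ∈ T, w i * D (y i) s) + Cs * (ρ x / (A * s)) ^ (-κ)) → ∀ (x : X) (r : ℝ), 1 ≤ r → r < ρ x → D x r ≤ C * (r / ρ x) ^ θ := by
  intro A ε κ Cs K₀ hA hε hκ
  obtain ⟨θ, C, hθ, h⟩ := rr_ci_core (ε := min ε 1) (Cs := max Cs 0) (K₀ := K₀) hA
    (lt_min hε one_pos) (min_le_right _ _) hκ (le_max_right _ _)
  refine ⟨θ, C, hθ, fun X ι ρ D hbdd hstep => h X ι ρ D hbdd fun x s hs hsA => ?_⟩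
  obtain ⟨T, w, y, hw, hyA, hsum, hband, hmain⟩ := hstep x s hs hsA
  have hA0 : 0 < A := by linarith
  have h1 : s * A < ρ x := (lt_div_iff₀ hA0).1 hsA
  have hρ : 0 < ρ x := lt_of_le_of_lt (by positivity) h1
  have hband' : ∀ B : ℝ, 1 ≤ B → A * B ≤ ρ x →
      (∑ i ∈ T.filter (fun i => ρ (y i) ≤ ρ x / (A * B)), w i) ≤ max Cs 0 * B ^ (-κ) := by
    intro B hB hAB
    have hB0 : (0 : ℝ) ≤ B ^ (-κ) := Real.rpow_nonneg (by linarith) _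
    exact (hband B hB hAB).trans (mul_le_mul_of_nonneg_right (le_max_left _ _) hB0)
  have hsk0 : (0 : ℝ) ≤ (ρ x / (A * s)) ^ (-κ) := Real.rpow_nonneg (by positivity) _
  have hmain' : D x s ≤ (∑ i ∈ T, w i * D (y i) s) + max Cs 0 * (ρ x / (A * s)) ^ (-κ) :=
    hmain.trans (add_le_add le_rfl (mul_le_mul_of_nonneg_right (le_max_left _ _) hsk0))
  exact ⟨T, w, y, hw, hyA, hsum.trans (sub_le_sub_left (min_le_left _ _) _), hband', hmain'⟩

end Summit.CriticalPhenomena.SAWScalingLimit.Theorems.AnnularMassDecay.Radial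

end
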